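import Summits.CriticalPhenomena.PercolationContinuityZ3.Theorems.PercNearOneGluingNoHeavyLowerTailKnQuestion8CoefficientwiseHarrisTwice
import HarnessLib

/-!
# Pendant-edge and sub-cube lemmas for the degree-two reduction of NO-CORE (prim-lf-2 gen 48, part 1 of 2)

Support file (`--supports stmt-CriticalPhenomena-4575`, closed), prover `prim-lf-2` (gen 48).  No definitions, no named facts, no sorries; standard axioms.
Memo `prim-lf-2/CW-HT-gen48.md` §3.  Part 2 (`…KnQuestion8CoefficientwiseNoCoreDegTwo.lean`) assembles the REDUCTION THEOREM
  `NO-CORE(y) = [same-colour Harris part] + Q_mix^{G−y}(p,q) + Q_mix^{G−y}(q,p)`   (CW-BOX-gen46 §2(d), CW-QMIX-gen47 §0)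
for a vertex `y ∉ {x}` with exactly two edges `i₁ = yp`, `i₂ = yq`.  Setting: finite multigraph `ends : ι → Sym2 V`, root `x`, colourings `s : Finset ι` (red) / `sᶜ` (blue),
`K(s) = openCluster (ends '' s) x`.  This file provides the graph-theoretic and bookkeeping pieces, none of which needs graph surgery:
* `openCluster_subset_of_adjClosed` (a set containing `x` and closed under red adjacency contains `C_x`), `not_mem_openCluster_of_no_edge`,
  `openCluster_insert_leafEdge` — PENDANT-EDGE LEMMA: if `T` has no edge at `y` and `e = ya`, then in `insert e T` the vertex `y` is a leaf at `a`:
  memberships of all `v ≠ y` are those of `T`, and `y ∈ C_x(insert e T) ↔ a ∈ C_x(T)`;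
* `mem_map_subtype_iff`, `mem_map_subtype_compl_iff`, `subtype_map_subtype_eq` — the sub-cube `Finset {j // P j}` inside `Finset ι` and its complement;
* `sameColour_part_nonneg` — the two-colouring sum over the colourings giving `i₁, i₂` THE SAME colour is `≥ 0` for all monotone `f, g`: it is the Harris sum
  (`harris_twoColouring`) of the cube on `ι ∖ {i₂}` pulled back along the monotone, complement-equivariant bijection `t ↦ t (+ i₂ iff i₁ ∈ t)`;
* `redBlue_part_eq` — the sum over the colourings with `i₁` red, `i₂` blue and `y` not doubly reached EQUALS the `Q_mix(p,q)` sum of `G − y` (edge type `{j // j ≠ i₁ ∧ j ≠ i₂}`),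
  for `f, g` ignoring `y` (pendant-edge lemma twice: `y` is a red leaf at `p` and a blue leaf at `q`).
[cite: KozmaNitzan2024, Questions 8–9 (§5.5 p. 36) (context: the Question-8 pocket covariance programme)]
-/

namespace Summit.CriticalPhenomena.PercolationContinuityZ3.Theorems

open Finset Literature.Probability.Percolation

namespace Coefficientwise

variable {ι V : Type*} [Fintype ι] [DecidableEq ι] (ends : ι → Sym2 V) (x : V)

omit [Fintype ι] [DecidableEq ι] in
/-- Closed-set principle: if `x ∈ W` and `W` is closed under adjacency in the red graph of `S`, then `C_x(S) ⊆ W`.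
[cite: KozmaNitzan2024, §5.5 (context only; elementary)] -/
theorem openCluster_subset_of_adjClosed (S : Set ι) (W : Set V) (hx : x ∈ W)
    (hW : ∀ a ∈ W, ∀ b, (openGraph (ends '' S)).Adj a b → b ∈ W) : openCluster (ends '' S) x ⊆ W := by
  intro v hv
  obtain ⟨walk⟩ := hv
  exact ((reachable_transfer W (G₂ := openGraph (ends '' S)) (fun a ha b hab => ⟨hab, hW a ha b hab⟩) walk) hx).2

omit [Fintype ι] in
/-- **Pendant-edge lemma.**  Let `T : Finset ι` contain no edge at `y`, and let `e` be an edge with ends `{y, a}`, `a ≠ y`, `x ≠ y`.  Then in the red graph of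
`insert e T` the vertex `y` is a leaf at `a`: for `v ≠ y`, `v ∈ C_x(insert e T) ↔ v ∈ C_x(T)`; `y ∈ C_x(insert e T) ↔ a ∈ C_x(T)`; and `y ∉ C_x(T)`.
[cite: KozmaNitzan2024, §5.5 (context only; elementary)] -/
theorem openCluster_insert_leafEdge (T : Finset ι) {y a : V} {e : ι} (he : ends e = s(y, a)) (hay : a ≠ y) (hxy : x ≠ y)
    (hT : ∀ i ∈ T, y ∉ ends i) :
    (∀ v, v ≠ y → (v ∈ openCluster (ends '' (↑(insert e T) : Set ι)) x ↔ v ∈ openCluster (ends '' (↑T : Set ι)) x)) ∧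
    (y ∈ openCluster (ends '' (↑(insert e T) : Set ι)) x ↔ a ∈ openCluster (ends '' (↑T : Set ι)) x) ∧
    y ∉ openCluster (ends '' (↑T : Set ι)) x := by
  classical
  set K₀ : Set V := openCluster (ends '' (↑T : Set ι)) x with hK₀
  set K₁ : Set V := openCluster (ends '' (↑(insert e T) : Set ι)) x with hK₁
  -- `y ∉ K₀`: no edge of `T` touches `y`
  have hyK₀ : y ∉ K₀ := by
    intro hy
    have hsub : K₀ ⊆ {v | v ≠ y} := by
      refine openCluster_subset_of_adjClosed ends x _ _ (by simpa using hxy) ?_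
      intro b _ c hbc
      rw [openGraph_image_adj] at hbc
      obtain ⟨⟨i, hiT, hi⟩, _⟩ := hbc
      intro hcy
      have : y ∈ ends i := by rw [hi, ← hcy]; exact Sym2.mem_mk_right b c
      exact hT i (Finset.mem_coe.mp hiT) this
    exact (hsub hy) rfl
  -- `K₁ ⊆ K₀ ∪ {y if a ∈ K₀}`
  set W : Set V := K₀ ∪ {v | v = y ∧ a ∈ K₀} with hW
  have hK₁W : K₁ ⊆ W := by
    refine openCluster_subset_of_adjClosed ends x _ W (Or.inl (mem_openCluster_self _ x)) ?_
    intro b hb c hbc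
    rw [openGraph_image_adj] at hbc
    obtain ⟨⟨i, hi1, hi⟩, hne⟩ := hbc
    rcases Finset.mem_insert.mp (Finset.mem_coe.mp hi1) with rfl | hiT
    · -- the edge is `e`: {b, c} = {y, a}
      have hbc' : s(b, c) = s(y, a) := by rw [← hi, he]
      rcases Sym2.eq_iff.mp hbc' with ⟨rfl, rfl⟩ | ⟨rfl, rfl⟩
      · -- b = y, c = a
        rcases hb with hb | hb
        · exact absurd hb hyK₀
        · exact Or.inl hb.2
      · -- b = a, c = y
        rcases hb with hb | hb
        · exact Or.inr ⟨rfl, hb⟩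
        · exact absurd hb.1 hay
    · -- the edge is in `T`: then `b ≠ y`-side reasoning: b ∈ K₀ (b = y impossible since T has no edge at y) and c ∈ K₀
      have hby : b ≠ y := by
        intro hby; subst hby
        exact hT i hiT (by rw [hi]; exact Sym2.mem_mk_left _ _)
      have hbK₀ : b ∈ K₀ := by
        rcases hb with hb | hb
        · exact hb
        · exact absurd hb.1 hby
      have hadj : (openGraph (ends '' (↑T : Set ι))).Adj b c := by
        rw [openGraph_image_adj]; exact ⟨⟨i, hiT, hi⟩, hne⟩
      exact Or.inl (hadj.reachable |> fun h => SimpleGraph.Reachable.trans hbK₀ h)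
  have hK₀K₁ : K₀ ⊆ K₁ := openCluster_image_mono ends (Finset.subset_insert e T) x
  refine ⟨fun v hvy => ⟨fun hv => ?_, fun hv => hK₀K₁ hv⟩, ⟨fun hy => ?_, fun ha => ?_⟩, hyK₀⟩
  · rcases hK₁W hv with h | h
    · exact h
    · exact absurd h.1 hvy
  · rcases hK₁W hy with h | h
    · exact absurd h hyK₀
    · exact h.2
  · have haK₁ : a ∈ K₁ := hK₀K₁ ha
    have hadj : (openGraph (ends '' (↑(insert e T) : Set ι))).Adj a y := by
      rw [openGraph_image_adj]
      exact ⟨⟨e, Finset.mem_insert_self e T, by rw [he, Sym2.eq_swap]⟩, hay⟩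
    exact SimpleGraph.Reachable.trans haK₁ hadj.reachable

omit [Fintype ι] [DecidableEq ι] in
/-- A function that ignores `y` takes the same value on two sets that agree off `y`, the second one avoiding `y`.
[cite: KozmaNitzan2024, §5.5 (context only; trivial)] -/
theorem apply_eq_of_agree_off {y : V} (F : Set V → ℝ) (hF : ∀ C : Set V, F (insert y C) = F C) {A B : Set V}
    (hAB : ∀ v, v ≠ y → (v ∈ A ↔ v ∈ B)) (hyB : y ∉ B) : F A = F B := by
  by_cases hyA : y ∈ A
  · have : A = insert y B := by
      ext v
      by_cases hv : v = y
      · subst hv; simp [hyA]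
      · simp only [Set.mem_insert_iff, hv, false_or]; exact hAB v hv
    rw [this, hF]
  · have : A = B := by
      ext v
      by_cases hv : v = y
      · subst hv; exact ⟨fun h => absurd h hyA, fun h => absurd h hyB⟩
      · exact hAB v hv
    rw [this]

section subcube

variable (P : ι → Prop) [DecidablePred P]

omit [Fintype ι] [DecidableEq ι] [DecidablePred P] ends x in
/-- Membership in the image of a sub-cube colouring. [cite: KozmaNitzan2024, §5.5 (context only; bookkeeping)] -/
theorem mem_map_subtype_iff (t : Finset {j // P j}) (a : ι) :
    a ∈ t.map (Function.Embedding.subtype P) ↔ ∃ h : P a, (⟨a, h⟩ : {j // P j}) ∈ t := by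
  constructor
  · intro ha
    obtain ⟨b, hb, rfl⟩ := Finset.mem_map.mp ha
    exact ⟨b.2, by simpa using hb⟩
  · rintro ⟨h, ht⟩
    exact Finset.mem_map.mpr ⟨⟨a, h⟩, ht, rfl⟩

omit ends x in
/-- The image of the complement in the sub-cube. [cite: KozmaNitzan2024, §5.5 (context only; bookkeeping)] -/
theorem mem_map_subtype_compl_iff (t : Finset {j // P j}) (a : ι) :
    a ∈ tᶜ.map (Function.Embedding.subtype P) ↔ P a ∧ a ∉ t.map (Function.Embedding.subtype P) := by
  rw [mem_map_subtype_iff, mem_map_subtype_iff]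
  constructor
  · rintro ⟨h, ht⟩
    exact ⟨h, fun ⟨h', ht'⟩ => (Finset.mem_compl.mp ht) ht'⟩
  · rintro ⟨h, hn⟩
    exact ⟨h, Finset.mem_compl.mpr fun ht => hn ⟨h, ht⟩⟩

omit [Fintype ι] [DecidableEq ι] ends x in
/-- Going to the sub-cube and back. [cite: KozmaNitzan2024, §5.5 (context only; bookkeeping)] -/
theorem subtype_map_subtype_eq (t : Finset {j // P j}) : (t.map (Function.Embedding.subtype P)).subtype P = t := by
  ext a
  rw [Finset.mem_subtype, mem_map_subtype_iff]
  exact ⟨fun ⟨_, h⟩ => h, fun h => ⟨a.2, h⟩⟩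

end subcube

section degtwo

variable {y p q : V} {i₁ i₂ : ι} (f g : Set V → ℝ)

/-- **Same-colour part.**  For monotone `f, g` and two edges `i₁ ≠ i₂`, the two-colouring sum restricted to the colourings giving `i₁, i₂` the same colour is `≥ 0`:
it is the Harris sum of the cube on `ι ∖ {i₂}` pulled back along the monotone, complement-equivariant map `t ↦ t (+ i₂ iff i₁ ∈ t)`.
[cite: KozmaNitzan2024, Questions 8–9 (§5.5 p. 36) (context)] -/
theorem sameColour_part_nonneg (hne : i₁ ≠ i₂) (hf : Monotone f) (hg : Monotone g) :
    0 ≤ ∑ s ∈ univ.filter (fun s : Finset ι => (i₁ ∈ s ↔ i₂ ∈ s)),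
      (f (openCluster (ends '' (↑s : Set ι)) x) - f (openCluster (ends '' (↑(sᶜ) : Set ι)) x)) *
        (g (openCluster (ends '' (↑s : Set ι)) x) - g (openCluster (ends '' (↑(sᶜ) : Set ι)) x)) := by
  classical
  set K : Finset ι → Set V := fun s => openCluster (ends '' (↑s : Set ι)) x with hK
  have hKmono : ∀ {s t : Finset ι}, s ⊆ t → K s ⊆ K t := fun hst => openCluster_image_mono ends hst x
  set Φ : Finset ι → ℝ := fun s => (f (K s) - f (K sᶜ)) * (g (K s) - g (K sᶜ)) with hΦ
  change 0 ≤ ∑ s ∈ univ.filter (fun s : Finset ι => (i₁ ∈ s ↔ i₂ ∈ s)), Φ s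
  -- the sub-cube on ι ∖ {i₂} and the pull-back map
  set emb := Function.Embedding.subtype (fun j : ι => j ≠ i₂) with hemb
  set φ : Finset {j : ι // j ≠ i₂} → Finset ι := fun t => if i₁ ∈ t.map emb then insert i₂ (t.map emb) else t.map emb with hφ
  have hi₂T : ∀ t : Finset {j : ι // j ≠ i₂}, i₂ ∉ t.map emb := fun t h => by
    obtain ⟨hP, _⟩ := (mem_map_subtype_iff (fun j : ι => j ≠ i₂) t i₂).mp h
    exact hP rfl
  have mem_φ : ∀ (t : Finset {j : ι // j ≠ i₂}) (a : ι), a ∈ φ t ↔ (a ∈ t.map emb ∨ (a = i₂ ∧ i₁ ∈ t.map emb)) := by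
    intro t a
    simp only [hφ]
    split_ifs with h
    · rw [Finset.mem_insert]; tauto
    · tauto
  have φ_compl : ∀ t : Finset {j : ι // j ≠ i₂}, φ tᶜ = (φ t)ᶜ := by
    intro t
    ext a
    rw [mem_φ, Finset.mem_compl, mem_φ, mem_map_subtype_compl_iff]
    have h1 : i₁ ∈ tᶜ.map emb ↔ i₁ ∉ t.map emb := by
      rw [mem_map_subtype_compl_iff]; exact ⟨fun h => h.2, fun h => ⟨hne, h⟩⟩
    rw [h1]
    by_cases ha : a = i₂
    · subst ha
      have := hi₂T t
      tauto
    · tauto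
  have φ_mono : Monotone φ := by
    intro t t' htt' a ha
    rw [mem_φ] at ha ⊢
    have hsub : t.map emb ⊆ t'.map emb := Finset.map_subset_map.mpr htt'
    rcases ha with ha | ⟨rfl, h1⟩
    · exact Or.inl (hsub ha)
    · exact Or.inr ⟨rfl, hsub h1⟩
  have φ_same : ∀ t : Finset {j : ι // j ≠ i₂}, (i₁ ∈ φ t ↔ i₂ ∈ φ t) := by
    intro t
    rw [mem_φ, mem_φ]
    have := hi₂T t
    constructor
    · rintro (h | ⟨h, _⟩)
      · exact Or.inr ⟨rfl, h⟩
      · exact absurd h hne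
    · rintro (h | ⟨_, h⟩)
      · exact absurd h this
      · exact Or.inl h
  -- reindex the restricted sum by φ
  have hre : ∑ s ∈ univ.filter (fun s : Finset ι => (i₁ ∈ s ↔ i₂ ∈ s)), Φ s = ∑ t : Finset {j : ι // j ≠ i₂}, Φ (φ t) := by
    refine (Finset.sum_nbij' (fun t => φ t) (fun s => s.subtype (fun j : ι => j ≠ i₂)) ?_ ?_ ?_ ?_ ?_).symm
    · intro t _; exact Finset.mem_filter.mpr ⟨Finset.mem_univ _, φ_same t⟩
    · intro s _; exact Finset.mem_univ _
    · intro t _; simp only [hφ]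
      split_ifs with h
      · ext a
        rw [Finset.mem_subtype, Finset.mem_insert]
        constructor
        · rintro (ha | ha)
          · exact absurd ha a.2
          · exact (subtype_map_subtype_eq (fun j : ι => j ≠ i₂) t) ▸ (Finset.mem_subtype.mpr ha)
        · intro ha; exact Or.inr ((mem_map_subtype_iff _ t a).mpr ⟨a.2, ha⟩)
      · exact subtype_map_subtype_eq (fun j : ι => j ≠ i₂) t
    · intro s hs
      have hs' : (i₁ ∈ s ↔ i₂ ∈ s) := (Finset.mem_filter.mp hs).2
      have hT : (s.subtype (fun j : ι => j ≠ i₂)).map emb = s.erase i₂ := by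
        rw [hemb, Finset.subtype_map]; ext a; simp [Finset.mem_erase, and_comm]
      simp only [hφ, hT]
      have h1 : (i₁ ∈ s.erase i₂ ↔ i₁ ∈ s) := by rw [Finset.mem_erase]; exact ⟨fun h => h.2, fun h => ⟨hne, h⟩⟩
      split_ifs with h
      · rw [h1] at h; exact Finset.insert_erase (hs'.mp h)
      · rw [h1] at h; exact Finset.erase_eq_of_notMem (fun h2 => h (hs'.mpr h2))
    · intro t _; rfl
  rw [hre]
  have hΦφ : ∀ t : Finset {j : ι // j ≠ i₂}, Φ (φ t) = (f (K (φ t)) - f (K (φ tᶜ))) * (g (K (φ t)) - g (K (φ tᶜ))) := by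
    intro t; simp only [hΦ, φ_compl]
  simp only [hΦφ]
  exact harris_twoColouring (fun t => f (K (φ t))) (fun t => g (K (φ t)))
    (fun t t' h => hf (hKmono (φ_mono h))) (fun t t' h => hg (hKmono (φ_mono h)))

open Classical in
/-- **The one-red-one-blue part is the two-point exclusion on `G − y`.**  If `y ∉ {x, p, q}` has exactly the two edges `i₁ = yp`, `i₂ = yq` and `f, g` ignore `y`, then
`Σ_{s : i₁ ∈ s, i₂ ∉ s, ¬(y ∈ K s ∧ y ∈ K sᶜ)} f̂(s)ĝ(s) = Σ_{t ⊆ ι∖{i₁,i₂} : ¬(p ∈ K″t ∧ q ∈ K″tᶜ)} f̂″(t)ĝ″(t)` — the `Q_mix(p,q)` sum of the multigraph `G − y` (edge type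
`{j // j ≠ i₁ ∧ j ≠ i₂}`).  (Pendant-edge lemma twice: `y` is a red leaf at `p` and a blue leaf at `q`.)  [cite: KozmaNitzan2024, Questions 8–9 (§5.5 p. 36) (context)] -/
theorem redBlue_part_eq (Pr : ι → Prop) [DecidablePred Pr] (hPr : ∀ j, Pr j ↔ (j ≠ i₁ ∧ j ≠ i₂))
    (hi₁ : ends i₁ = s(y, p)) (hi₂ : ends i₂ = s(y, q)) (hne : i₁ ≠ i₂)
    (hdeg : ∀ i, y ∈ ends i → i = i₁ ∨ i = i₂) (hpy : p ≠ y) (hqy : q ≠ y) (hxy : x ≠ y)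
    (hfy : ∀ C : Set V, f (insert y C) = f C) (hgy : ∀ C : Set V, g (insert y C) = g C) :
    ∑ s ∈ univ.filter (fun s : Finset ι => i₁ ∈ s ∧ i₂ ∉ s ∧
        ¬ (y ∈ openCluster (ends '' (↑s : Set ι)) x ∧ y ∈ openCluster (ends '' (↑(sᶜ) : Set ι)) x)),
      (f (openCluster (ends '' (↑s : Set ι)) x) - f (openCluster (ends '' (↑(sᶜ) : Set ι)) x)) *
        (g (openCluster (ends '' (↑s : Set ι)) x) - g (openCluster (ends '' (↑(sᶜ) : Set ι)) x)) =
    ∑ t ∈ univ.filter (fun t : Finset {j : ι // Pr j} =>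
        ¬ (p ∈ openCluster ((fun j : {j : ι // Pr j} => ends j.1) '' (↑t : Set {j : ι // Pr j})) x ∧
           q ∈ openCluster ((fun j : {j : ι // Pr j} => ends j.1) '' (↑(tᶜ) : Set {j : ι // Pr j})) x)),
      (f (openCluster ((fun j : {j : ι // Pr j} => ends j.1) '' (↑t : Set {j : ι // Pr j})) x) -
          f (openCluster ((fun j : {j : ι // Pr j} => ends j.1) '' (↑(tᶜ) : Set {j : ι // Pr j})) x)) *
        (g (openCluster ((fun j : {j : ι // Pr j} => ends j.1) '' (↑t : Set {j : ι // Pr j})) x) -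
          g (openCluster ((fun j : {j : ι // Pr j} => ends j.1) '' (↑(tᶜ) : Set {j : ι // Pr j})) x)) := by
  classical
  set K : Finset ι → Set V := fun s => openCluster (ends '' (↑s : Set ι)) x with hK
  set emb := Function.Embedding.subtype Pr with hemb
  set K'' : Finset {j : ι // Pr j} → Set V := fun t => openCluster ((fun j : {j : ι // Pr j} => ends j.1) '' (↑t : Set {j : ι // Pr j})) x with hK''
  -- the sub-cube cluster is the cluster of the image colouring
  have hKT : ∀ t : Finset {j : ι // Pr j}, K'' t = K (t.map emb) := by
    intro t
    simp only [hK'', hK, Finset.coe_map, Set.image_image]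
    rfl
  have hnoT : ∀ t : Finset {j : ι // Pr j}, ∀ i ∈ t.map emb, y ∉ ends i := by
    intro t i hi hyi
    obtain ⟨hP, _⟩ := (mem_map_subtype_iff Pr t i).mp hi
    have hP' := (hPr i).mp hP
    rcases hdeg i hyi with rfl | rfl
    · exact hP'.1 rfl
    · exact hP'.2 rfl
  have hi₁T : ∀ t : Finset {j : ι // Pr j}, i₁ ∉ t.map emb := fun t h => ((hPr i₁).mp ((mem_map_subtype_iff Pr t i₁).mp h).1).1 rfl
  have hi₂T : ∀ t : Finset {j : ι // Pr j}, i₂ ∉ t.map emb := fun t h => ((hPr i₂).mp ((mem_map_subtype_iff Pr t i₂).mp h).1).2 rfl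
  -- the reindexing maps
  set jj : Finset {j : ι // Pr j} → Finset ι := fun t => insert i₁ (t.map emb) with hjj
  set ii : Finset ι → Finset {j : ι // Pr j} := fun s => s.subtype Pr with hii
  have hcompl : ∀ t : Finset {j : ι // Pr j}, (jj t)ᶜ = insert i₂ (tᶜ.map emb) := by
    intro t; ext a
    rw [Finset.mem_compl, hjj, Finset.mem_insert, Finset.mem_insert, mem_map_subtype_compl_iff]
    have h1 := hi₁T t; have h2 := hi₂T t
    by_cases ha2 : a = i₂
    · subst ha2; simp only [true_or, iff_true]; rintro (h | h); exact hne (h.symm); exact h2 h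
    · by_cases ha1 : a = i₁
      · subst ha1; simp [hPr, ha2]
      · simp only [ha1, false_or, ha2]; exact ⟨fun h => ⟨(hPr a).mpr ⟨ha1, ha2⟩, h⟩, fun h => h.2⟩
  -- pendant facts for s = jj t
  have pend₁ : ∀ t : Finset {j : ι // Pr j},
      (∀ v, v ≠ y → (v ∈ K (jj t) ↔ v ∈ K'' t)) ∧ (y ∈ K (jj t) ↔ p ∈ K'' t) ∧ y ∉ K'' t := by
    intro t; rw [hKT t]; exact openCluster_insert_leafEdge ends x (t.map emb) hi₁ hpy hxy (hnoT t)
  have pend₂ : ∀ t : Finset {j : ι // Pr j},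
      (∀ v, v ≠ y → (v ∈ K (jj t)ᶜ ↔ v ∈ K'' tᶜ)) ∧ (y ∈ K (jj t)ᶜ ↔ q ∈ K'' tᶜ) ∧ y ∉ K'' tᶜ := by
    intro t; rw [hKT tᶜ, hcompl t]; exact openCluster_insert_leafEdge ends x (tᶜ.map emb) hi₂ hqy hxy (hnoT tᶜ)
  have hval : ∀ t : Finset {j : ι // Pr j},
      (f (K (jj t)) - f (K (jj t)ᶜ)) * (g (K (jj t)) - g (K (jj t)ᶜ)) = (f (K'' t) - f (K'' tᶜ)) * (g (K'' t) - g (K'' tᶜ)) := by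
    intro t
    obtain ⟨a1, _, c1⟩ := pend₁ t
    obtain ⟨a2, _, c2⟩ := pend₂ t
    rw [apply_eq_of_agree_off f hfy a1 c1, apply_eq_of_agree_off f hfy a2 c2, apply_eq_of_agree_off g hgy a1 c1, apply_eq_of_agree_off g hgy a2 c2]
  have hkey : ∀ t : Finset {j : ι // Pr j},
      (jj t ∈ univ.filter (fun s : Finset ι => i₁ ∈ s ∧ i₂ ∉ s ∧ ¬ (y ∈ K s ∧ y ∈ K sᶜ))) ↔
        (t ∈ univ.filter (fun t : Finset {j : ι // Pr j} => ¬ (p ∈ K'' t ∧ q ∈ K'' tᶜ))) := by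
    intro t
    simp only [Finset.mem_filter, Finset.mem_univ, true_and]
    rw [(pend₁ t).2.1, (pend₂ t).2.1]
    have h1 : i₁ ∈ jj t := Finset.mem_insert_self _ _
    have h2 : i₂ ∉ jj t := fun h => by
      rcases Finset.mem_insert.mp h with h | h
      · exact hne h.symm
      · exact hi₂T t h
    tauto
  have hleft : ∀ s ∈ univ.filter (fun s : Finset ι => i₁ ∈ s ∧ i₂ ∉ s ∧ ¬ (y ∈ K s ∧ y ∈ K sᶜ)), jj (ii s) = s := by
    intro s hs
    obtain ⟨hs1, hs2, _⟩ := (Finset.mem_filter.mp hs).2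
    simp only [hjj, hii, hemb, Finset.subtype_map]
    ext a
    simp only [Finset.mem_insert, Finset.mem_filter]
    constructor
    · rintro (rfl | ⟨ha, _⟩); exact hs1; exact ha
    · intro ha
      by_cases ha1 : a = i₁
      · exact Or.inl ha1
      · refine Or.inr ⟨ha, (hPr a).mpr ⟨ha1, ?_⟩⟩; rintro rfl; exact hs2 ha
  have hright : ∀ t : Finset {j : ι // Pr j}, ii (jj t) = t := by
    intro t
    simp only [hii, hjj]
    ext a
    rw [Finset.mem_subtype, Finset.mem_insert]
    constructor
    · rintro (ha | ha)
      · exact absurd ha ((hPr a).mp a.2).1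
      · have := (mem_map_subtype_iff Pr t a).mp ha; obtain ⟨_, h⟩ := this; exact h
    · intro ha; exact Or.inr ((mem_map_subtype_iff Pr t a).mpr ⟨a.2, ha⟩)
  change ∑ s ∈ univ.filter (fun s : Finset ι => i₁ ∈ s ∧ i₂ ∉ s ∧ ¬ (y ∈ K s ∧ y ∈ K sᶜ)), (f (K s) - f (K sᶜ)) * (g (K s) - g (K sᶜ)) =
    ∑ t ∈ univ.filter (fun t : Finset {j : ι // Pr j} => ¬ (p ∈ K'' t ∧ q ∈ K'' tᶜ)), (f (K'' t) - f (K'' tᶜ)) * (g (K'' t) - g (K'' tᶜ))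
  refine Finset.sum_nbij' ii jj ?_ ?_ hleft (fun t _ => hright t) ?_
  · intro s hs
    have := (hkey (ii s)).mp
    rw [hleft s hs] at this
    exact this hs
  · intro t ht; exact (hkey t).mpr ht
  · intro s hs
    rw [← hval (ii s), hleft s hs]

omit [Fintype ι] [DecidableEq ι] in
/-- If no edge of `S` touches `y ≠ x` then `y ∉ C_x(S)`. [cite: KozmaNitzan2024, §5.5 (context only; elementary)] -/
theorem not_mem_openCluster_of_no_edge (S : Finset ι) (hxy : x ≠ y) (hS : ∀ i ∈ S, y ∉ ends i) :
    y ∉ openCluster (ends '' (↑S : Set ι)) x := by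
  intro hy
  have hsub : openCluster (ends '' (↑S : Set ι)) x ⊆ {v | v ≠ y} := by
    refine openCluster_subset_of_adjClosed ends x _ _ (by simpa using hxy) ?_
    intro b _ c hbc hcy
    rw [openGraph_image_adj] at hbc
    obtain ⟨⟨i, hiS, hi⟩, _⟩ := hbc
    have : y ∈ ends i := by rw [hi, ← hcy]; exact Sym2.mem_mk_right b c
    exact hS i (Finset.mem_coe.mp hiS) this
  exact (hsub hy) rfl


end degtwo

end Coefficientwise

end Summit.CriticalPhenomena.PercolationContinuityZ3.Theorems
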